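import Summits.NavierStokesRegularity.NavierStokesRegularity.Theorems.PlaneEnergyCeilingPlanarEnergyAPrioriPlanarYoung
import Summits.NavierStokesRegularity.NavierStokesRegularity.Theorems.PlaneEnergyCeilingPlanarEnergyLiouvilleSmallCorner
import HarnessLib

/-!
# Small planar data: the two a priori inequalities behind the propagation of planar energies

Route `PlaneEnergyCeiling`, crux `PlanarEnergyAPriori` (stmt-NavierStokesRegularity-16855), small-data
corner, second tool file. For a field `w` on `ℝ³` solving the Oseen integral equation from a base
time `t₀`,
`w(t) = e^{(t−t₀)Δ} w(t₀) − B_{t₀}(w,w)(t)`,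
we bound at time `t`

* the planar kinetic energies (`planarEnergy_le_of_oseenRepr`):
  `(∫_{plane} ‖w(t)‖²)^{1/2} ≤ χ₀ + C₁ ∫_{t₀}^t (t−s)^{-1/2} ψ(s) χ(s) ds`
  whenever `w(t₀)` has planar energies `≤ χ₀²`, and on `(t₀,t)` the slices obey `‖w(s)‖ ≤ ψ(s)` and
  have planar energies `≤ χ(s)²` (heat flow: planar contraction; Duhamel term: Minkowski in time
  and the planar Young inequality for the Oseen slice, `PlanarYoung.lean`);
* the velocity (`norm_le_of_oseenRepr`):
  `‖w(t,x)‖ ≤ C_h √(2V₁) χ₀ /√(t−t₀) + ∫_{t₀}^t g(s) ds` for any majorant `g(s)` of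
  `‖N_{t−s}[w(s),w(s)]‖_∞` (caloric smoothing of Morrey data, `norm_heatExtension_le_of_morrey`),
  together with the two slice majorants used downstream: the KNSS sup bound
  `C₀ (t−s)^{-1/2} ψ(s)²` and the Morrey bound `K · 2χ(s)² · (t−s)^{-3/2}` (planar ceiling ⇒ Morrey
  bound `2χ²`, `exists_norm_oseenSlice_origin_le_of_morrey` translated to every point).

## References

* G. Koch, N. Nadirashvili, G. Seregin, V. Šverák, Acta Math. 203 (2009), §3–§4 (arXiv:0709.3599).
  [KochNadirashviliSereginSverak2009]
* E. M. Stein, *Singular Integrals* (1970), App. A.1. [SteinSingularIntegrals1970]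
-/

noncomputable section

-- single-conjunct summit: `Summit.<Summit>.<Problem>` repeats the name by the D-0017 layout
set_option linter.dupNamespace false

namespace Summit.NavierStokesRegularity.NavierStokesRegularity.Theorems.PlanarEnergyAPriori.SmallData

open MeasureTheory Set Function Filter Topology TopologicalSpace Metric WithLp
open scoped NNReal ENNReal
open Literature.Analysis Literature.Analysis.FluidPDE Literature.Analysis.FunctionSpaces
open Summit.NavierStokesRegularity.NavierStokesRegularity.Theorems.PlaneEnergyCeilingPlanarEnergyLiouville
  (norm_heatExtension_le_of_morrey lintegral_ball_zero_translate_le)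

/-! ### The Oseen slice under a Morrey bound, at every point -/

/-- **Translating the Oseen slice to the origin**: `N_τ[a,b](x) = N_τ[a(· + x), b(· + x)](0)`
(translation invariance of Lebesgue measure). [folklore] -/
theorem oseenSlice_eq_translate_zero {τ : ℝ} (a b : EuclideanSpace ℝ (Fin 3) → EuclideanSpace ℝ (Fin 3))
    (x : EuclideanSpace ℝ (Fin 3)) :
    oseenSlice τ a b x = oseenSlice τ (fun y => a (y + x)) (fun y => b (y + x)) 0 := by
  rw [oseenSlice_apply, oseenSlice_apply,
    ← integral_sub_right_eq_self (fun y => oseenKernel τ (0 - y) (a (y + x)) (b (y + x))) x]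
  refine integral_congr_ae (Eventually.of_forall fun y => ?_)
  simp only [sub_add_cancel]
  congr 1
  abel

/-- **The Oseen slice of Morrey data, at every point.** There is an absolute `K > 0` such that for a
field `a` on `ℝ³` with `∫⁻_{B_r(y)} ‖a‖ₑ² ≤ I r` at every centre and radius (`I ≥ 0`) and `τ > 0`,
`‖N_τ[a,a](x)‖ ≤ K I τ^{-3/2}` (`= K I √τ/τ²`) for every `x`.
[cite: KochNadirashviliSereginSverak2009, §3 (3.8) and §4 (4.3)] -/
theorem exists_norm_oseenSlice_le_of_morrey :
    ∃ K : ℝ, 0 < K ∧ ∀ {a : EuclideanSpace ℝ (Fin 3) → EuclideanSpace ℝ (Fin 3)} {τ I : ℝ}, 0 < τ → 0 ≤ I →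
      (∀ (y : EuclideanSpace ℝ (Fin 3)) (r : ℝ), 0 < r →
        ∫⁻ z in ball y r, ‖a z‖ₑ ^ 2 ≤ ENNReal.ofReal (I * r)) →
      ∀ x, ‖oseenSlice τ a a x‖ ≤ K * I * (Real.sqrt τ / τ ^ 2) := by
  obtain ⟨K, hK, h⟩ := exists_norm_oseenSlice_origin_le_of_morrey
  refine ⟨K, hK, fun {a τ I} hτ hI hMor x => ?_⟩
  rw [oseenSlice_eq_translate_zero]
  refine h hτ le_rfl hI fun r hr => ?_
  have hr0 : 0 < r := lt_of_lt_of_le (Real.sqrt_pos.2 hτ) hr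
  exact lintegral_ball_zero_translate_le hMor x hr0

/-- **The Oseen slice of a continuous field with a planar ceiling.** With the constant `K` of
`exists_norm_oseenSlice_le_of_morrey`: if the continuous field `a` has planar energies `≤ χ²` on
every plane, then `‖N_τ[a,a](x)‖ ≤ K (2χ²) √τ/τ²` (planar ceiling ⇒ Morrey bound `2χ² r`). [folklore] -/
theorem norm_oseenSlice_le_of_planar {K : ℝ}
    (hK : ∀ {a : EuclideanSpace ℝ (Fin 3) → EuclideanSpace ℝ (Fin 3)} {τ I : ℝ}, 0 < τ → 0 ≤ I →
      (∀ (y : EuclideanSpace ℝ (Fin 3)) (r : ℝ), 0 < r →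
        ∫⁻ z in ball y r, ‖a z‖ₑ ^ 2 ≤ ENNReal.ofReal (I * r)) →
      ∀ x, ‖oseenSlice τ a a x‖ ≤ K * I * (Real.sqrt τ / τ ^ 2))
    {a : EuclideanSpace ℝ (Fin 3) → EuclideanSpace ℝ (Fin 3)} (ha : Continuous a) {χ : ℝ}
    (hpl : ∀ (R : EuclideanSpace ℝ (Fin 3) ≃ₗᵢ[ℝ] EuclideanSpace ℝ (Fin 3)) (c : ℝ),
      ∫⁻ y : EuclideanSpace ℝ (Fin 2), ‖a (R (toLp 2 ![y 0, y 1, c]))‖ₑ ^ 2 ≤ ENNReal.ofReal (χ ^ 2))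
    {τ : ℝ} (hτ : 0 < τ) (x : EuclideanSpace ℝ (Fin 3)) :
    ‖oseenSlice τ a a x‖ ≤ K * (2 * χ ^ 2) * (Real.sqrt τ / τ ^ 2) := by
  refine hK hτ (by positivity) (fun y r hr => ?_) x
  have h := PlanarEnergyAPriori.planeEnergyCeiling_scaledEnergyOfPlanar a ha (χ ^ 2) (sq_nonneg χ) hpl y r hr
  rwa [show 2 * r * χ ^ 2 = 2 * χ ^ 2 * r by ring] at h

/-! ### Real/`ℝ≥0∞` bookkeeping -/

/-- `(ofReal (a²))^{1/2} = ofReal a` for `a ≥ 0`. [folklore] -/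
theorem ofReal_sq_rpow_half {a : ℝ} (ha : 0 ≤ a) :
    (ENNReal.ofReal (a ^ 2)) ^ (1 / 2 : ℝ) = ENNReal.ofReal a := by
  rw [ENNReal.ofReal_rpow_of_nonneg (sq_nonneg a) (by norm_num), ← Real.sqrt_eq_rpow, Real.sqrt_sq ha]

/-- `(ofReal a)^2 = ofReal (a²)` (real exponent) for `a ≥ 0`. [folklore] -/
theorem ofReal_rpow_two {a : ℝ} (ha : 0 ≤ a) :
    (ENNReal.ofReal a) ^ (2 : ℝ) = ENNReal.ofReal (a ^ 2) := by
  rw [ENNReal.ofReal_rpow_of_nonneg ha (by norm_num), Real.rpow_two]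

/-! ### The planar energies at time `t` -/

/-- **Planar energies along the Oseen representation.** There is an absolute `C₁ > 0` (the constant
of `planar_oseenSlice_le`) such that: if `w(t) = e^{(t−t₀)Δ}w(t₀) − B_{t₀}(w,w)(t)` pointwise, `w`
jointly measurable with continuous slices, `w(t₀)` has planar energies `≤ χ₀²`, and on `(t₀, t)` the
slices satisfy `‖w(s)‖ ≤ ψ(s)` and have planar energies `≤ χ(s)²` (`χ ≥ 0`), with
`s ↦ (t−s)^{-1/2} ψ(s) χ(s)` integrable on `(t₀,t)`, then on every plane
`∫ ‖w(t)‖² ≤ (χ₀ + C₁ ∫_{t₀}^t (t−s)^{-1/2} ψ(s) χ(s) ds)²`.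
[cite: KochNadirashviliSereginSverak2009, §4 p. 8; SteinSingularIntegrals1970, App. A.1] -/
theorem planarEnergy_le_of_oseenRepr :
    ∃ C₁ : ℝ, 0 < C₁ ∧ ∀ {w : ℝ → EuclideanSpace ℝ (Fin 3) → EuclideanSpace ℝ (Fin 3)},
      Measurable (uncurry w) → (∀ s, Continuous (w s)) → ∀ {t₀ t : ℝ}, t₀ < t →
      (∀ x, w t x = UnboundedOperators.heatExtension (w t₀) (t - t₀) x - oseenDuhamel 1 t₀ w w t x) →
      ∀ {χ₀ : ℝ}, 0 ≤ χ₀ →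
      (∀ (R : EuclideanSpace ℝ (Fin 3) ≃ₗᵢ[ℝ] EuclideanSpace ℝ (Fin 3)) (c : ℝ),
        ∫⁻ y : EuclideanSpace ℝ (Fin 2), ‖w t₀ (R (toLp 2 ![y 0, y 1, c]))‖ₑ ^ 2 ≤ ENNReal.ofReal (χ₀ ^ 2)) →
      ∀ {χ ψ : ℝ → ℝ}, (∀ s ∈ Ioo t₀ t, 0 ≤ χ s) →
      (∀ s ∈ Ioo t₀ t, ∀ (R : EuclideanSpace ℝ (Fin 3) ≃ₗᵢ[ℝ] EuclideanSpace ℝ (Fin 3)) (c : ℝ),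
        ∫⁻ y : EuclideanSpace ℝ (Fin 2), ‖w s (R (toLp 2 ![y 0, y 1, c]))‖ₑ ^ 2 ≤ ENNReal.ofReal (χ s ^ 2)) →
      (∀ s ∈ Ioo t₀ t, ∀ x, ‖w s x‖ ≤ ψ s) →
      IntegrableOn (fun s => (t - s) ^ (-(1 / 2 : ℝ)) * (ψ s * χ s)) (Ioo t₀ t) →
      ∀ (R : EuclideanSpace ℝ (Fin 3) ≃ₗᵢ[ℝ] EuclideanSpace ℝ (Fin 3)) (c : ℝ),
        ∫⁻ y : EuclideanSpace ℝ (Fin 2), ‖w t (R (toLp 2 ![y 0, y 1, c]))‖ₑ ^ 2 ≤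
          ENNReal.ofReal ((χ₀ + C₁ * ∫ s in Ioo t₀ t, (t - s) ^ (-(1 / 2 : ℝ)) * (ψ s * χ s)) ^ 2) := by
  obtain ⟨C₁, hC₁, hS⟩ := planar_oseenSlice_le
  refine ⟨C₁, hC₁, ?_⟩
  intro w hwm hws t₀ t ht hrep χ₀ hχ₀ hX0 χ ψ hχ hXs hψ hint R c
  set Pl : EuclideanSpace ℝ (Fin 2) → EuclideanSpace ℝ (Fin 3) := fun y => R (toLp 2 ![y 0, y 1, c])
    with hPl
  have hσ : 0 < t - t₀ := sub_pos.2 ht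
  -- nonnegativity of `ψ` on `(t₀, t)`
  have hψ0 : ∀ s ∈ Ioo t₀ t, 0 ≤ ψ s := fun s hs => (norm_nonneg _).trans (hψ s hs 0)
  -- the integrand and its integral
  set F : ℝ → ℝ := fun s => (t - s) ^ (-(1 / 2 : ℝ)) * (ψ s * χ s) with hF
  have hF0 : ∀ s ∈ Ioo t₀ t, 0 ≤ F s := fun s hs => by
    have h1 : 0 ≤ (t - s) ^ (-(1 / 2 : ℝ)) := Real.rpow_nonneg (by linarith [hs.2]) _
    exact mul_nonneg h1 (mul_nonneg (hψ0 s hs) (hχ s hs))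
  set J : ℝ := ∫ s in Ioo t₀ t, F s with hJ
  have hJ0 : 0 ≤ J := setIntegral_nonneg measurableSet_Ioo hF0
  -- the heat term
  have hheat : eLpNorm (fun y => UnboundedOperators.heatExtension (w t₀) (t - t₀) (Pl y)) 2 volume ≤
      ENNReal.ofReal χ₀ := by
    have h := eLpNorm_two_le_rpow_of_lintegral_sq_le
      (planar_heatExtension_le (hws t₀) hX0 hσ R c)
    rwa [ofReal_sq_rpow_half hχ₀] at h
  -- the Duhamel term
  have hm : ∀ s ∈ Ioo t₀ t, ∀ (R' : EuclideanSpace ℝ (Fin 3) ≃ₗᵢ[ℝ] EuclideanSpace ℝ (Fin 3)) (c' : ℝ),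
      eLpNorm (fun y : EuclideanSpace ℝ (Fin 2) =>
        oseenSlice (t - s) (w s) (w s) (R' (toLp 2 ![y 0, y 1, c']))) 2 volume ≤
          ENNReal.ofReal (C₁ * F s) := by
    intro s hs R' c'
    have hτ : 0 < t - s := by linarith [hs.2]
    have h := hS (hws s) (hws s) (hψ s hs) (hXs s hs) hτ R' c'
    rw [ofReal_sq_rpow_half (hχ s hs), ← ENNReal.ofReal_mul (by
      have := hψ0 s hs; have := Real.rpow_nonneg hτ.le (-(1 / 2 : ℝ)); positivity)] at h
    refine h.trans (le_of_eq ?_)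
    congr 1
    simp only [hF]
    ring
  have hduh : eLpNorm (fun y => oseenDuhamel 1 t₀ w w t (Pl y)) 2 volume ≤ ENNReal.ofReal (C₁ * J) := by
    refine (planar_oseenDuhamel_le hwm hm R c).trans (le_of_eq ?_)
    have hint' : IntegrableOn (fun s => C₁ * F s) (Ioo t₀ t) := hint.const_mul C₁
    have hnn : 0 ≤ᵐ[volume.restrict (Ioo t₀ t)] fun s => C₁ * F s := by
      filter_upwards [ae_restrict_mem measurableSet_Ioo] with s hs
      exact mul_nonneg hC₁.le (hF0 s hs)
    rw [← ofReal_integral_eq_lintegral_ofReal hint' hnn, integral_const_mul]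
  -- triangle inequality
  have hmeas_h := aestronglyMeasurable_plane_heatExtension (hws t₀) (t - t₀) R c
  have hmeas_d := aestronglyMeasurable_plane_oseenDuhamel hwm t₀ t R c
  have htri : eLpNorm (fun y => w t (Pl y)) 2 volume ≤ ENNReal.ofReal (χ₀ + C₁ * J) := by
    have heq : (fun y => w t (Pl y)) = (fun y => UnboundedOperators.heatExtension (w t₀) (t - t₀) (Pl y)) -
        fun y => oseenDuhamel 1 t₀ w w t (Pl y) := by
      funext y
      simp only [Pi.sub_apply]
      exact hrep (Pl y)
    rw [heq]
    calc eLpNorm ((fun y => UnboundedOperators.heatExtension (w t₀) (t - t₀) (Pl y)) -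
          fun y => oseenDuhamel 1 t₀ w w t (Pl y)) 2 volume
        ≤ eLpNorm (fun y => UnboundedOperators.heatExtension (w t₀) (t - t₀) (Pl y)) 2 volume +
            eLpNorm (fun y => oseenDuhamel 1 t₀ w w t (Pl y)) 2 volume :=
          eLpNorm_sub_le hmeas_h hmeas_d one_le_two
      _ ≤ ENNReal.ofReal χ₀ + ENNReal.ofReal (C₁ * J) := add_le_add hheat hduh
      _ = ENNReal.ofReal (χ₀ + C₁ * J) := (ENNReal.ofReal_add hχ₀ (by positivity)).symm
  have h := lintegral_le_of_eLpNorm_two_le htri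
  rwa [ofReal_rpow_two (by positivity)] at h

/-! ### The velocity at time `t` -/

/-- **The velocity along the Oseen representation.** If `w(t) = e^{(t−t₀)Δ}w(t₀) − B_{t₀}(w,w)(t)`
pointwise with `w(t₀)` continuous of planar energies `≤ χ₀²`, and `g(s)` is an integrable majorant of
`‖N_{t−s}[w(s),w(s)]‖_∞` on `(t₀, t)`, then
`‖w(t,x)‖ ≤ 2048 (4π)^{-3/2} √(V₁ · 2χ₀²)/√(t−t₀) + ∫_{t₀}^t g(s) ds` (caloric smoothing of the
Morrey datum `2χ₀²`, and the Duhamel integral bounded slice by slice).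
[cite: KochNadirashviliSereginSverak2009, §3 (3.8), §4 p. 8] -/
theorem norm_le_of_oseenRepr {w : ℝ → EuclideanSpace ℝ (Fin 3) → EuclideanSpace ℝ (Fin 3)} {t₀ t : ℝ}
    (ht : t₀ < t) (hcont : Continuous (w t₀))
    (hrep : ∀ x, w t x = UnboundedOperators.heatExtension (w t₀) (t - t₀) x - oseenDuhamel 1 t₀ w w t x)
    {χ₀ : ℝ}
    (hX0 : ∀ (R : EuclideanSpace ℝ (Fin 3) ≃ₗᵢ[ℝ] EuclideanSpace ℝ (Fin 3)) (c : ℝ),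
      ∫⁻ y : EuclideanSpace ℝ (Fin 2), ‖w t₀ (R (toLp 2 ![y 0, y 1, c]))‖ₑ ^ 2 ≤ ENNReal.ofReal (χ₀ ^ 2))
    {g : ℝ → ℝ} (hg : ∀ s ∈ Ioo t₀ t, ∀ x, ‖oseenSlice (t - s) (w s) (w s) x‖ ≤ g s)
    (hgi : IntegrableOn g (Ioo t₀ t)) (x : EuclideanSpace ℝ (Fin 3)) :
    ‖w t x‖ ≤ 2048 * (4 * Real.pi) ^ (-(3 : ℝ) / 2) *
        Real.sqrt ((volume (ball (0 : EuclideanSpace ℝ (Fin 3)) 1)).toReal * (2 * χ₀ ^ 2)) / Real.sqrt (t - t₀) +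
      ∫ s in Ioo t₀ t, g s := by
  have hσ : 0 < t - t₀ := sub_pos.2 ht
  -- Morrey bound of the datum
  have hMor : ∀ (y : EuclideanSpace ℝ (Fin 3)) (r : ℝ), 0 < r →
      ∫⁻ z in ball y r, ‖w t₀ z‖ₑ ^ 2 ≤ ENNReal.ofReal (2 * χ₀ ^ 2 * r) := by
    intro y r hr
    have h := PlanarEnergyAPriori.planeEnergyCeiling_scaledEnergyOfPlanar (w t₀) hcont (χ₀ ^ 2) (sq_nonneg χ₀)
      hX0 y r hr
    rwa [show 2 * r * χ₀ ^ 2 = 2 * χ₀ ^ 2 * r by ring] at h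
  have hheat := norm_heatExtension_le_of_morrey hcont.aestronglyMeasurable (by positivity : (0 : ℝ) ≤ 2 * χ₀ ^ 2)
    hMor hσ x
  -- the Duhamel term
  have hduh : ‖oseenDuhamel 1 t₀ w w t x‖ ≤ ∫ s in Ioo t₀ t, g s := by
    rw [oseenDuhamel_one_eq_setIntegral_oseenSlice]
    refine norm_integral_le_of_norm_le hgi ?_
    filter_upwards [ae_restrict_mem measurableSet_Ioo] with s hs
    exact hg s hs x
  rw [hrep x]
  exact (norm_sub_le _ _).trans (add_le_add hheat hduh)

/-- **The KNSS slice majorant**: `‖N_{t−s}[w(s),w(s)](x)‖ ≤ C₀ (t−s)^{-1/2} ψ(s)²` whenever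
`‖w(s)‖ ≤ ψ(s)`, `s < t` (`C₀ = oseenSliceConst`). [cite: KochNadirashviliSereginSverak2009, §3 (3.5)] -/
theorem norm_oseenSlice_le_of_bound {w : ℝ → EuclideanSpace ℝ (Fin 3) → EuclideanSpace ℝ (Fin 3)}
    {s t : ℝ} (hst : s < t) {ψs : ℝ} (hψ : ∀ x, ‖w s x‖ ≤ ψs) (x : EuclideanSpace ℝ (Fin 3)) :
    ‖oseenSlice (t - s) (w s) (w s) x‖ ≤
      oseenSliceConst (EuclideanSpace ℝ (Fin 3)) * (t - s) ^ (-(1 / 2 : ℝ)) * ψs * ψs :=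
  norm_oseenSlice_le_oseenSliceConst (sub_pos.2 hst) hψ hψ x

/-! ### Registered form -/

/-- **Planar energies along the Oseen representation, closed form** (registered sub-goal of
stmt-NavierStokesRegularity-16855): the statement of `planarEnergy_le_of_oseenRepr` with the heat
extension and the Duhamel term fully qualified. [cite: KochNadirashviliSereginSverak2009, §4 p. 8; SteinSingularIntegrals1970, App. A.1] -/
theorem planarEnergy_le_of_oseenRepr_closedForm :
    ∃ C₁ : ℝ, 0 < C₁ ∧ ∀ (w : ℝ → EuclideanSpace ℝ (Fin 3) → EuclideanSpace ℝ (Fin 3)),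
      Measurable (Function.uncurry w) → (∀ s, Continuous (w s)) → ∀ (t₀ t : ℝ), t₀ < t →
      (∀ x, w t x = Literature.Analysis.UnboundedOperators.heatExtension (w t₀) (t - t₀) x -
        Literature.Analysis.FluidPDE.oseenDuhamel 1 t₀ w w t x) →
      ∀ (χ₀ : ℝ), 0 ≤ χ₀ →
      (∀ (R : EuclideanSpace ℝ (Fin 3) ≃ₗᵢ[ℝ] EuclideanSpace ℝ (Fin 3)) (c : ℝ),
        ∫⁻ y : EuclideanSpace ℝ (Fin 2), ‖w t₀ (R (WithLp.toLp 2 ![y 0, y 1, c]))‖ₑ ^ 2 ≤ ENNReal.ofReal (χ₀ ^ 2)) →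
      ∀ (χ ψ : ℝ → ℝ), (∀ s ∈ Set.Ioo t₀ t, 0 ≤ χ s) →
      (∀ s ∈ Set.Ioo t₀ t, ∀ (R : EuclideanSpace ℝ (Fin 3) ≃ₗᵢ[ℝ] EuclideanSpace ℝ (Fin 3)) (c : ℝ),
        ∫⁻ y : EuclideanSpace ℝ (Fin 2), ‖w s (R (WithLp.toLp 2 ![y 0, y 1, c]))‖ₑ ^ 2 ≤ ENNReal.ofReal (χ s ^ 2)) →
      (∀ s ∈ Set.Ioo t₀ t, ∀ x, ‖w s x‖ ≤ ψ s) →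
      MeasureTheory.IntegrableOn (fun s => (t - s) ^ (-(1 / 2 : ℝ)) * (ψ s * χ s)) (Set.Ioo t₀ t) MeasureTheory.volume →
      ∀ (R : EuclideanSpace ℝ (Fin 3) ≃ₗᵢ[ℝ] EuclideanSpace ℝ (Fin 3)) (c : ℝ),
        ∫⁻ y : EuclideanSpace ℝ (Fin 2), ‖w t (R (WithLp.toLp 2 ![y 0, y 1, c]))‖ₑ ^ 2 ≤
          ENNReal.ofReal ((χ₀ + C₁ * ∫ s in Set.Ioo t₀ t, (t - s) ^ (-(1 / 2 : ℝ)) * (ψ s * χ s)) ^ 2) := by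
  obtain ⟨C₁, hC₁, h⟩ := planarEnergy_le_of_oseenRepr
  exact ⟨C₁, hC₁, fun w hwm hws t₀ t ht hrep χ₀ hχ₀ hX0 χ ψ hχ hXs hψ hint R c =>
    h hwm hws ht hrep hχ₀ hX0 hχ hXs hψ hint R c⟩

end Summit.NavierStokesRegularity.NavierStokesRegularity.Theorems.PlanarEnergyAPriori.SmallData

end
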